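import Literature.AnabelianGeometry.SemiGraphs.ProSigmaPuncturedSurfaceElastic
import Literature.AnabelianGeometry.AbsoluteAnabelian.MLFGaloisGroupsProofs
import HarnessLib

/-!
# Pro-`Σ` completions of free groups detect the index of a subgroup (Schreier's formula, pro-`Σ` form)

S. Mochizuki, *Topics in Absolute Anabelian Geometry I: Generalities*, J. Math. Sci. Univ. Tokyo **19**
(2012) [AbsTopI], Def 2.1 (i) p. 17 / Prop 2.3 (i) p. 19 (the almost pro-`Σ` quotient `Δ_X` of a
hyperbolic curve: `Ker(Δ_X → Gal(Y/X))` is the maximal pro-`Σ` quotient of `π₁(Y)`); S. Mochizuki,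
*Semi-graphs of anabelioids*, Publ. RIMS **42** (2006) [SemiAnbd], Example 2.10 p. 31 (pro-`Σ` completions
of surface groups); R. C. Lyndon, P. E. Schupp, *Combinatorial Group Theory*, Ch. I Prop. 3.9 (a
subgroup of index `j` in a free group of rank `n` is free of rank `j (n − 1) + 1`).

PROOF-ONLY file (abc-iut cell, seat abc-iut-f-053; no definitions, no named facts): the AFFINE (free
surface group) half of the rank count that closes [AbsTopI] Prop 2.3 (i) at the GFG construction of
Def 2.1 (i) (abc-iut L4 row «P23i-FN-ORIGIN-GFG-MODEL», abc-iut-w6-d030; there the CLOSED case uses the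
genus count `g′ − 1 = q (g″ − 1)` of `surfaceGroupFiniteIndexSubgroup_holds`).  For a free group `Γ` on
finitely many generators (`n := |Generators Γ|`), a subgroup `K ≤ Γ` of finite index, pro-`Σ` completions
`ι₂ : Γ → P₂` and `ι₁ : K → P₁` (`P₁`, `P₂` profinite) and a prime `ℓ ∈ Σ`:

* `freeProlRank_eq_card_generators_of_isProSigmaCompletion` — `δ¹_ℓ(P₂) = n` (abc-iut-L4-t15's
  `freeProlRank_eq_card_of_isProSigmaCompletion_freeGroup`, transported along `IsFreeGroup.toFreeGroup`);
* `freeProlRank_add_index_of_isProSigmaCompletion_subgroup` — **Schreier's formula, pro-`Σ` form**: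
  `δ¹_ℓ(P₁) + [Γ : K] = [Γ : K] · n + 1` (the tree's Schreier basis
  `SchreierIndex.exists_freeGroupBasis_of_finiteIndex` + the previous item for the free group `K`);
* `index_eq_one_of_freeProlRank_eq` / **`index_eq_one_of_continuousMulEquiv`** — for `n ≥ 2`:
  `δ¹_ℓ(P₁) = δ¹_ℓ(P₂)` (in particular `P₁ ≅ P₂` as topological groups) forces `[Γ : K] = 1`; contrapositive
  `isEmpty_continuousMulEquiv_of_two_le_index`.

Classical (Schreier 1927 / Lyndon–Schupp I.3.9, [SemiAnbd] Ex. 2.10); OUR kernel check; nothing here bears on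
[IUTchIII] Cor. 3.12; no side is taken.
-/

noncomputable section

namespace Literature.AnabelianGeometry.SemiGraphs.SemiGraphOfAnabelioids.IsProSigmaCompletion

open Literature.AnabelianGeometry.AbsoluteAnabelian
open Literature.GroupTheory.CombinatorialGroupTheory

universe u v

variable {Sigma : Set ℕ} {Γ : Type u} [Group Γ] [IsFreeGroup Γ] [Finite (IsFreeGroup.Generators Γ)]
  {P₁ : Type v} [Group P₁] [TopologicalSpace P₁] [IsTopologicalGroup P₁]
  {P₂ : Type v} [Group P₂] [TopologicalSpace P₂] [IsTopologicalGroup P₂]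

/-! ### The rank of a pro-`Σ` completion of a finitely generated free group -/

/-- **`δ¹_ℓ(P) = |ι|` for a pro-`Σ` completion `P` of a group with a FINITE free basis indexed by `ι`**
(`ℓ ∈ Σ` prime): transport of `freeProlRank_eq_card_of_isProSigmaCompletion_freeGroup` along the basis
isomorphism `Γ ≃* F(ι)`. [cite: MochizukiSemiAnbd2006, Ex. 2.10 p.31] -/
theorem freeProlRank_eq_card_of_isProSigmaCompletion_basis {K : Type u} [Group K] {ι : Type u} [Finite ι]
    (b : FreeGroupBasis ι K) [CompactSpace P₁] {j : K →* P₁} (hj : IsProSigmaCompletion Sigma j) {ℓ : ℕ}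
    [Fact ℓ.Prime] (hℓ : ℓ ∈ Sigma) : freeProlRank P₁ ℓ = (Nat.card ι : ℕ∞) := by
  classical
  haveI : Fintype ι := Fintype.ofFinite ι
  -- `j ∘ b.repr⁻¹ : F(ι) → P₁` is again a pro-`Σ` completion
  have hj' : IsProSigmaCompletion Sigma (j.comp b.repr.symm.toMonoidHom) :=
    hj.of_comp_mulEquiv b.repr.symm fun _ => rfl
  rw [freeProlRank_eq_card_of_isProSigmaCompletion_freeGroup hj' hℓ, Nat.card_eq_fintype_card]

/-- **`δ¹_ℓ(P₂) = |Generators Γ|`** for a pro-`Σ` completion `ι₂ : Γ → P₂` of a free group with finitely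
many free generators, `ℓ ∈ Σ` prime. [cite: MochizukiSemiAnbd2006, Ex. 2.10 p.31] -/
theorem freeProlRank_eq_card_generators_of_isProSigmaCompletion [CompactSpace P₂] {ι₂ : Γ →* P₂}
    (hι₂ : IsProSigmaCompletion Sigma ι₂) {ℓ : ℕ} [Fact ℓ.Prime] (hℓ : ℓ ∈ Sigma) :
    freeProlRank P₂ ℓ = (Nat.card (IsFreeGroup.Generators Γ) : ℕ∞) :=
  freeProlRank_eq_card_of_isProSigmaCompletion_basis (IsFreeGroup.basis Γ) hι₂ hℓ

/-! ### Schreier's index formula, read on the pro-`Σ` completions -/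

/-- **Schreier's formula, pro-`Σ` form**: for `K ≤ Γ` of finite index in a free group `Γ` with `n`
free generators and a pro-`Σ` completion `ι₁ : K → P₁` (`ℓ ∈ Σ` prime),
`δ¹_ℓ(P₁) + [Γ : K] = [Γ : K] · n + 1` — `K` is free of rank `[Γ : K](n − 1) + 1`
(`SchreierIndex.exists_freeGroupBasis_of_finiteIndex`). [cite: LyndonSchupp2001, Ch. I Prop. 3.9] -/
theorem freeProlRank_add_index_of_isProSigmaCompletion_subgroup [CompactSpace P₁] (K : Subgroup Γ)
    [K.FiniteIndex] {ι₁ : K →* P₁} (hι₁ : IsProSigmaCompletion Sigma ι₁) {ℓ : ℕ} [Fact ℓ.Prime]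
    (hℓ : ℓ ∈ Sigma) :
    freeProlRank P₁ ℓ + (K.index : ℕ∞) =
      ((K.index * Nat.card (IsFreeGroup.Generators Γ) + 1 : ℕ) : ℕ∞) := by
  obtain ⟨ι, b, hfin, hcard⟩ := SchreierIndex.exists_freeGroupBasis_of_finiteIndex K
  haveI := hfin
  rw [freeProlRank_eq_card_of_isProSigmaCompletion_basis b hι₁ hℓ, ← hcard]
  push_cast
  rfl

/-- The same as a natural-number identity: `δ¹_ℓ(P₁)` IS the natural number
`[Γ : K] · (n − 1) + 1` (for `n ≥ 1`; ℕ-subtraction). [cite: LyndonSchupp2001, Ch. I Prop. 3.9] -/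
theorem freeProlRank_eq_of_isProSigmaCompletion_subgroup [CompactSpace P₁]
    (hn : 1 ≤ Nat.card (IsFreeGroup.Generators Γ)) (K : Subgroup Γ)
    [K.FiniteIndex] {ι₁ : K →* P₁} (hι₁ : IsProSigmaCompletion Sigma ι₁) {ℓ : ℕ} [Fact ℓ.Prime]
    (hℓ : ℓ ∈ Sigma) :
    freeProlRank P₁ ℓ = ((K.index * (Nat.card (IsFreeGroup.Generators Γ) - 1) + 1 : ℕ) : ℕ∞) := by
  obtain ⟨ι, b, hfin, hcard⟩ := SchreierIndex.exists_freeGroupBasis_of_finiteIndex K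
  haveI := hfin
  rw [freeProlRank_eq_card_of_isProSigmaCompletion_basis b hι₁ hℓ, Nat.cast_inj]
  set n := Nat.card (IsFreeGroup.Generators Γ) with hn'
  set j := K.index with hj
  -- `|ι| + j = j * n + 1` and `j * n = j * (n - 1) + j`, so `|ι| = j * (n - 1) + 1`
  have hmul : j * n = j * (n - 1) + j := by
    conv_lhs => rw [← Nat.sub_add_cancel hn, Nat.mul_add, Nat.mul_one]
  omega

/-! ### Rigidity: isomorphic completions force index one -/

/-- **Equal pro-`ℓ` ranks force index one.**  For a free group `Γ` with `n ≥ 2` free generators, `K ≤ Γ`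
of finite index, and pro-`Σ` completions `ι₁ : K → P₁`, `ι₂ : Γ → P₂` with `δ¹_ℓ(P₁) = δ¹_ℓ(P₂)` for some
prime `ℓ ∈ Σ`: `[Γ : K] = 1` (Schreier: `δ¹_ℓ(P₁) − 1 = [Γ : K](n − 1)` while `δ¹_ℓ(P₂) − 1 = n − 1 > 0`).  (The hypothesis `n ≥ 1` of the
rank formula is needed: for the trivial free group the truncated formula would fail.)
[cite: LyndonSchupp2001, Ch. I Prop. 3.9] -/
theorem index_eq_one_of_freeProlRank_eq [CompactSpace P₁] [CompactSpace P₂]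
    (hn : 2 ≤ Nat.card (IsFreeGroup.Generators Γ)) (K : Subgroup Γ) [K.FiniteIndex]
    {ι₁ : K →* P₁} (hι₁ : IsProSigmaCompletion Sigma ι₁) {ι₂ : Γ →* P₂}
    (hι₂ : IsProSigmaCompletion Sigma ι₂) {ℓ : ℕ} [Fact ℓ.Prime] (hℓ : ℓ ∈ Sigma)
    (h : freeProlRank P₁ ℓ = freeProlRank P₂ ℓ) : K.index = 1 := by
  rw [freeProlRank_eq_of_isProSigmaCompletion_subgroup (by omega) K hι₁ hℓ,
    freeProlRank_eq_card_generators_of_isProSigmaCompletion hι₂ hℓ, Nat.cast_inj] at h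
  have hidx : 1 ≤ K.index := Nat.one_le_iff_ne_zero.mpr Subgroup.FiniteIndex.index_ne_zero
  -- `K.index * (n - 1) + 1 = n` with `n ≥ 2` forces `K.index = 1`
  set n := Nat.card (IsFreeGroup.Generators Γ) with hn'
  have h1 : K.index * (n - 1) = 1 * (n - 1) := by omega
  have h2 : 0 < n - 1 := by omega
  exact Nat.eq_of_mul_eq_mul_right h2 h1

/-- **Pro-`Σ` completions detect the index**: for a free group `Γ` with `n ≥ 2` free generators and
`K ≤ Γ` of finite index, a topological isomorphism between a pro-`Σ` completion of `K` and one of `Γ`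
(`Σ` containing a prime) forces `[Γ : K] = 1` — the affine twin of the genus count `g′ − 1 = q (g″ − 1)`
for closed surface groups. [cite: MochizukiAbsTopI2012, Prop 2.3 (i) p.19] -/
theorem index_eq_one_of_continuousMulEquiv [CompactSpace P₁] [CompactSpace P₂]
    (hn : 2 ≤ Nat.card (IsFreeGroup.Generators Γ)) (K : Subgroup Γ) [K.FiniteIndex]
    {ι₁ : K →* P₁} (hι₁ : IsProSigmaCompletion Sigma ι₁) {ι₂ : Γ →* P₂}
    (hι₂ : IsProSigmaCompletion Sigma ι₂) {ℓ : ℕ} (hℓp : ℓ.Prime) (hℓ : ℓ ∈ Sigma) (e : P₁ ≃ₜ* P₂) :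
    K.index = 1 :=
  haveI : Fact ℓ.Prime := ⟨hℓp⟩
  index_eq_one_of_freeProlRank_eq hn K hι₁ hι₂ hℓ (freeProlRank_eq_of_continuousMulEquiv e ℓ)

/-- Equivalently: `K = ⊤`. [cite: MochizukiAbsTopI2012, Prop 2.3 (i) p.19] -/
theorem eq_top_of_continuousMulEquiv [CompactSpace P₁] [CompactSpace P₂]
    (hn : 2 ≤ Nat.card (IsFreeGroup.Generators Γ)) (K : Subgroup Γ) [K.FiniteIndex]
    {ι₁ : K →* P₁} (hι₁ : IsProSigmaCompletion Sigma ι₁) {ι₂ : Γ →* P₂}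
    (hι₂ : IsProSigmaCompletion Sigma ι₂) {ℓ : ℕ} (hℓp : ℓ.Prime) (hℓ : ℓ ∈ Sigma) (e : P₁ ≃ₜ* P₂) :
    K = ⊤ :=
  Subgroup.index_eq_one.mp (index_eq_one_of_continuousMulEquiv hn K hι₁ hι₂ hℓp hℓ e)

/-- **Contrapositive**: for `[Γ : K] ≥ 2` there is NO topological isomorphism between a pro-`Σ` completion
of `K` and one of `Γ`. [cite: MochizukiAbsTopI2012, Prop 2.3 (i) p.19] -/
theorem isEmpty_continuousMulEquiv_of_two_le_index [CompactSpace P₁] [CompactSpace P₂]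
    (hn : 2 ≤ Nat.card (IsFreeGroup.Generators Γ)) (K : Subgroup Γ) [K.FiniteIndex] (hK : 2 ≤ K.index)
    {ι₁ : K →* P₁} (hι₁ : IsProSigmaCompletion Sigma ι₁) {ι₂ : Γ →* P₂}
    (hι₂ : IsProSigmaCompletion Sigma ι₂) {ℓ : ℕ} (hℓp : ℓ.Prime) (hℓ : ℓ ∈ Sigma) :
    IsEmpty (P₁ ≃ₜ* P₂) :=
  ⟨fun e => by have := index_eq_one_of_continuousMulEquiv hn K hι₁ hι₂ hℓp hℓ e; omega⟩

/-- **The punctured surface groups**: for a hyperbolic AFFINE type `(g, r)` (`r ≥ 1`, `2g − 2 + r > 0`) the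
group `Γ_{g,r}` is free on `2g + r − 1 ≥ 2` generators, so the rigidity applies to it: a pro-`Σ`
completion of a subgroup `K ≤ Γ_{g,k+1}` of index `≥ 2` is never topologically isomorphic to a pro-`Σ`
completion of `Γ_{g,k+1}` (`Σ` containing a prime).  [cite: MochizukiAbsTopI2012, Prop 2.3 (i) p.19] -/
theorem isEmpty_continuousMulEquiv_puncturedSurfaceGroup [CompactSpace P₁] [CompactSpace P₂] {g k : ℕ}
    (hgk : PuncturedSurfaceGroup.IsHyperbolicType g (k + 1)) (K : Subgroup (PuncturedSurfaceGroup g (k + 1)))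
    [K.FiniteIndex] (hK : 2 ≤ K.index) {ι₁ : K →* P₁} (hι₁ : IsProSigmaCompletion Sigma ι₁)
    {ι₂ : PuncturedSurfaceGroup g (k + 1) →* P₂} (hι₂ : IsProSigmaCompletion Sigma ι₂) {ℓ : ℕ}
    (hℓp : ℓ.Prime) (hℓ : ℓ ∈ Sigma) : IsEmpty (P₁ ≃ₜ* P₂) := by
  classical
  obtain ⟨e⟩ := PuncturedSurfaceGroup.nonempty_mulEquiv_freeGroup g k
  -- transport everything to the free group `F := FreeGroup (Fin g × Bool ⊕ Fin k)`
  let F := FreeGroup (Fin g × Bool ⊕ Fin k)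
  let K' : Subgroup F := K.map (e : PuncturedSurfaceGroup g (k + 1) →* F)
  have hidx : K'.index = K.index := Subgroup.index_map_of_bijective e.bijective K
  haveI : K'.FiniteIndex := ⟨by rw [hidx]; exact Subgroup.FiniteIndex.index_ne_zero⟩
  have hK' : 2 ≤ K'.index := by rw [hidx]; exact hK
  -- the generators of `F`
  have hgen : Nat.card (IsFreeGroup.Generators F) = 2 * g + k := by
    rw [Nat.card_congr (Equiv.ofFreeGroupEquiv (IsFreeGroup.toFreeGroup F)).symm, Nat.card_eq_fintype_card,
      Fintype.card_sum, Fintype.card_prod, Fintype.card_fin, Fintype.card_bool, Fintype.card_fin]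
    ring
  haveI : Finite (IsFreeGroup.Generators F) :=
    Finite.of_equiv _ (Equiv.ofFreeGroupEquiv (IsFreeGroup.toFreeGroup F))
  have hn : 2 ≤ Nat.card (IsFreeGroup.Generators F) := by
    rw [hgen]
    unfold PuncturedSurfaceGroup.IsHyperbolicType at hgk
    omega
  -- the completions, transported
  let eK : K ≃* K' := e.subgroupMap K
  have hι₁' : IsProSigmaCompletion Sigma (ι₁.comp eK.symm.toMonoidHom) :=
    hι₁.of_comp_mulEquiv eK.symm fun _ => rfl
  have hι₂' : IsProSigmaCompletion Sigma (ι₂.comp e.symm.toMonoidHom) :=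
    hι₂.of_comp_mulEquiv e.symm fun _ => rfl
  exact isEmpty_continuousMulEquiv_of_two_le_index hn K' hK' hι₁' hι₂' hℓp hℓ

/-! ### The index is an invariant of the completion (appended, abc-iut-f-053 gen 3) -/

/-- **The pro-`ℓ` rank of the completion DETERMINES the index**: for a free group `Γ` with `n ≥ 2` free
generators, finite-index subgroups `K₁, K₂ ≤ Γ` whose pro-`Σ` completions have the same `δ¹_ℓ` (some prime `ℓ ∈ Σ`)
have the same index — `δ¹_ℓ = [Γ : K](n − 1) + 1` is strictly increasing in `[Γ : K]`.
[cite: LyndonSchupp2001, Ch. I Prop. 3.9] -/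
theorem index_eq_index_of_freeProlRank_eq [CompactSpace P₁] [CompactSpace P₂]
    (hn : 2 ≤ Nat.card (IsFreeGroup.Generators Γ)) (K₁ K₂ : Subgroup Γ) [K₁.FiniteIndex] [K₂.FiniteIndex]
    {ι₁ : K₁ →* P₁} (hι₁ : IsProSigmaCompletion Sigma ι₁) {ι₂ : K₂ →* P₂} (hι₂ : IsProSigmaCompletion Sigma ι₂)
    {ℓ : ℕ} [Fact ℓ.Prime] (hℓ : ℓ ∈ Sigma) (h : freeProlRank P₁ ℓ = freeProlRank P₂ ℓ) :
    K₁.index = K₂.index := by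
  have hn1 : 1 ≤ Nat.card (IsFreeGroup.Generators Γ) := by omega
  rw [freeProlRank_eq_of_isProSigmaCompletion_subgroup hn1 K₁ hι₁ hℓ,
    freeProlRank_eq_of_isProSigmaCompletion_subgroup hn1 K₂ hι₂ hℓ, Nat.cast_inj] at h
  have h' : K₁.index * (Nat.card (IsFreeGroup.Generators Γ) - 1) =
      K₂.index * (Nat.card (IsFreeGroup.Generators Γ) - 1) := by omega
  exact Nat.eq_of_mul_eq_mul_right (by omega) h'

/-- **Isomorphic completions have the same index**: if the pro-`Σ` completions of two finite-index subgroups of a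
free group of rank `≥ 2` are isomorphic as topological groups, the indices agree (`Σ` containing a prime `ℓ`).
[cite: LyndonSchupp2001, Ch. I Prop. 3.9] -/
theorem index_eq_index_of_continuousMulEquiv [CompactSpace P₁] [CompactSpace P₂]
    (hn : 2 ≤ Nat.card (IsFreeGroup.Generators Γ)) (K₁ K₂ : Subgroup Γ) [K₁.FiniteIndex] [K₂.FiniteIndex]
    {ι₁ : K₁ →* P₁} (hι₁ : IsProSigmaCompletion Sigma ι₁) {ι₂ : K₂ →* P₂} (hι₂ : IsProSigmaCompletion Sigma ι₂)
    {ℓ : ℕ} (hℓp : ℓ.Prime) (hℓ : ℓ ∈ Sigma) (e : P₁ ≃ₜ* P₂) : K₁.index = K₂.index :=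
  haveI : Fact ℓ.Prime := ⟨hℓp⟩
  index_eq_index_of_freeProlRank_eq hn K₁ K₂ hι₁ hι₂ hℓ (freeProlRank_eq_of_continuousMulEquiv e ℓ)

/-- **Subgroups of different index have non-isomorphic pro-`Σ` completions** (free group of rank `≥ 2`, `Σ`
containing a prime). [cite: LyndonSchupp2001, Ch. I Prop. 3.9] -/
theorem isEmpty_continuousMulEquiv_of_index_ne [CompactSpace P₁] [CompactSpace P₂]
    (hn : 2 ≤ Nat.card (IsFreeGroup.Generators Γ)) (K₁ K₂ : Subgroup Γ) [K₁.FiniteIndex] [K₂.FiniteIndex]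
    (hne : K₁.index ≠ K₂.index) {ι₁ : K₁ →* P₁} (hι₁ : IsProSigmaCompletion Sigma ι₁) {ι₂ : K₂ →* P₂}
    (hι₂ : IsProSigmaCompletion Sigma ι₂) {ℓ : ℕ} (hℓp : ℓ.Prime) (hℓ : ℓ ∈ Sigma) : IsEmpty (P₁ ≃ₜ* P₂) :=
  ⟨fun e => hne (index_eq_index_of_continuousMulEquiv hn K₁ K₂ hι₁ hι₂ hℓp hℓ e)⟩

end Literature.AnabelianGeometry.SemiGraphs.SemiGraphOfAnabelioids.IsProSigmaCompletion

end
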